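import Summits.AtomisticToContinuum.HydrodynamicLimit.Theorems.OneFlightGossipEngineEnergyCurrentTailsLossIntensityFloor4MixingGlue
import HarnessLib

/-!
# The lagged kinetic-window loss-intensity floor LIF₄ᴸ from QMF₄ᴸ and the flux ceiling
# (stub `stub_lossIntensityFloor4L_of_mixingFlux4L`, line `quartic-schur-ledger`, crux `EnergyCurrentTails`,
# stmt-AtomisticToContinuum-9235; seat c6 reshape A)

Registered glue stub `QMF₄ᴸ → S2a″ → LIF₄ᴸ` of the lead's skeleton
`Cruxes/EnergyCurrentTails/Lines/quartic_schur_ledger.lean` (seat c6, reshape A): the landed LIF₄″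
(`stub_lossIntensityFloor4_of_mixingFlux4`, module `…LossIntensityFloor4MixingGlue`) restricted to
the single kinetic window `(s, s′]`, `s′ = s + h_N`, `h_N = (N+1)^{-1/3}`, `0 ≤ s`, `s′ ≤ T`, with
the left-hand time integral of the cut-off fourth moment `M₄^{>K₀} = (N+1)⁻¹Σᵢ 𝟙{K₀<‖vᵢ‖}‖vᵢ‖⁴`
taken over the first half-window `(s, s + h_N/2]` only (the "lag"), both in the lower primitive
(now QMF₄ᴸ, thermal rate `ofReal(cν)·∫_s^{s+h_N/2} M₄^{>K₀} ≤ E[Σ_{coll∈(s,s′]} Σ_{ordered contact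
pairs} 𝟙{K₀<‖v₁⁻‖}(N+1)⁻¹·2‖v₁⁺‖²‖v₂⁺‖²]`) and in the conclusion.  The left-hand integral is only
carried through (it is an opaque `ℝ≥0∞` quantity in the arithmetic `c5lif_assembly`); the
right-hand side lives on the full window `(s, s′]`, where S2a″ is applied with `s ≤ s′`
(`h_N > 0`, `Real.rpow_pos_of_pos`) and `s′ ≤ T`.  Per ORDERED collision record
(`pre = ‖v₁⁻‖⁴+‖v₂⁻‖⁴`, `post = ‖v₁⁺‖⁴+‖v₂⁺‖⁴`, `mix± = ‖v₁±‖²‖v₂±‖²`; pair energy conservation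
`E² = pre + 2mix⁻ = post + 2mix⁺`): `2mix⁺ = (pre − post) + 2mix⁻ ≤ 2(pre−post)₊/2 + 2mix⁻`
(`c5lif_ofReal_mixpostSum_le`).
Proof, in `ℝ≥0∞`: (1) `I′ = I` (same cut-off, same half-window); (2) QMF₄ᴸ, whose `∑ᶠ` right side
is `ofReal` of the real collision sum of `𝟙{K₀<‖preVel.1‖}(N+1)⁻¹·2‖postVel.1‖²‖postVel.2‖²` on
the conull good set (bridge `c5lif2_bridge_mixpost_cutoff`); (3) drop the cut-off record by record
(`c5lif2_cutoffMixSum_le_mixSum`); (4) the one-sided Povzner identity summed and integrated, the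
one splitting of an integral of a sum using the a.e.-measurability of the flux integrand
(`c5lif_aemeasurable_fluxSum`); (5) S2a″ on the window `(s, s′]`; (6) the arithmetic
`c5lif_assembly` (`δ = 1`): `(c/2)ν∫_s^{s+h_N/2} M₄^{>K₀} ≤ Loss(s,s′] + Cν(s′−s)·sup m₂·sup m₃`.
Constants: `σ₀ = min(σ₁, σ₃, 1/2)`, `δ_LIF = c/2`, `K₀ = K₀^{QMF₄ᴸ}`, `C_LIF = C`, `N₀ = max N₁ N₃`.
References: Bobylev 1997; Mischler–Wennberg 1999 (Povzner with exact energy-split variables);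
Cercignani–Illner–Pulvirenti 1994 §4.2, App. 4.A.
-/

noncomputable section

open MeasureTheory Set Filter
open scoped ENNReal InnerProductSpace

namespace Summit.AtomisticToContinuum.HydrodynamicLimit.Theorems.QuarticSchurLedger

open Literature.MathematicalPhysics.KineticTheory Literature.Analysis.FluidPDE

/-- **Stub LIF₄ᴸ — THE LAGGED KINETIC-WINDOW QUARTIC LOSS-INTENSITY FLOOR FROM THE MIXING FLOOR
QMF₄ᴸ AND THE FLUX CEILING** (registered glue stub of the line `quartic-schur-ledger`, crux
stmt-AtomisticToContinuum-9235 `EnergyCurrentTails`; seat c6 reshape A): `QMF₄ᴸ → S2a″ → LIF₄ᴸ` —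
for every horizon `T > 0` and flow family there are `δ > 0`, `K₀ ≥ 0`, `C ≥ 0`, `N₀` with, for
`N ≥ N₀`, `h_N = (N+1)^{-1/3}` and `0 ≤ s`, `s + h_N ≤ T`,
`δ ν_N ∫_s^{s+h_N/2} M₄^{>K₀}(r) dr ≤ Loss_N(s, s+h_N] + C ν_N h_N · sup m₂ · sup m₃` (see the
module doc-string for the proof; `δ_LIF = c_QMF₄ᴸ/2`, `K₀ = K₀^{QMF₄ᴸ}`, `C = C_{S2a″}`).
[folklore] -/
theorem stub_lossIntensityFloor4L_of_mixingFlux4L :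
    (∀ (a₀ θ₀ : T3 → ℝ) (u₀ : T3 → V3), Continuous a₀ → Continuous θ₀ → Continuous u₀ → (∀ x, 0 < a₀ x) → (∀
    x, 0 < θ₀ x) → ∃ σ₀ : ℝ, 0 < σ₀ ∧ ∀ σ : ℝ, 0 < σ → σ < σ₀ → ∀ T : ℝ, 0 < T → ∀ Φ : ((N : ℕ) →
    HardSphereFlow (Torus.geometry (Fin 3)) (hsDiameter σ N) (N + 1)), ∃ K₀ : ℝ, 0 ≤ K₀ ∧ ∃ c : ℝ, 0 < c ∧ ∃
    N₀ : ℕ, ∀ N : ℕ, N₀ ≤ N → ∀ s : ℝ, 0 ≤ s → s + ((N : ℝ) + 1) ^ (-(1 / 3 : ℝ)) ≤ T → ENNReal.ofReal (c *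
    (σ ^ 2 * ((N + 1 : ℕ) : ℝ) ^ ((1 : ℝ) / 3))) * ∫⁻ τ in Set.Ioc s (s + ((N : ℝ) + 1) ^ (-(1 / 3 : ℝ)) /
    2), (∫⁻ z, ENNReal.ofReal (((N + 1 : ℕ) : ℝ)⁻¹ * ∑ i : Fin (N + 1), if K₀ < ‖(((Φ N).flow τ z) i).2‖
    then ‖(((Φ N).flow τ z) i).2‖ ^ 4 else 0) ∂(localGibbsLaw σ a₀ u₀ θ₀ N (Φ N))) ≤ ∫⁻ z, (∑ᶠ τ ∈
    collisionTimes (Torus.geometry (Fin 3)) (hsDiameter σ N) (fun r => (Φ N).flow r z) ∩ Set.Ioc s (s + ((N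
    : ℝ) + 1) ^ (-(1 / 3 : ℝ))), ∑ i : Fin (N + 1), ∑ j : Fin (N + 1), if i = j then (0 : ℝ≥0∞) else
    (contactSet (Torus.geometry (Fin 3)) (N + 1) (hsDiameter σ N) i j).indicator (fun y => if K₀ <
    ‖((collidePair (Torus.geometry (Fin 3)) i j y) i).2‖ then ENNReal.ofReal (((N + 1 : ℕ) : ℝ)⁻¹ * (2 *
    (‖(y i).2‖ ^ 2 * ‖(y j).2‖ ^ 2))) else 0) ((Φ N).flow τ z)) ∂(localGibbsLaw σ a₀ u₀ θ₀ N (Φ N))) → (∀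
    (a₀ θ₀ : T3 → ℝ) (u₀ : T3 → V3), Continuous a₀ → Continuous θ₀ → Continuous u₀ → (∀ x, 0 < a₀ x) → (∀ x,
    0 < θ₀ x) → ∃ σ₀ : ℝ, 0 < σ₀ ∧ ∀ σ : ℝ, 0 < σ → σ < σ₀ → ∀ T : ℝ, 0 < T → ∀ Φ : ((N : ℕ) →
    HardSphereFlow (Torus.geometry (Fin 3)) (hsDiameter σ N) (N + 1)), ∃ C : ℝ, 0 ≤ C ∧ ∃ N₀ : ℕ, ∀ N : ℕ,
    N₀ ≤ N → ∀ s s' : ℝ, 0 ≤ s → s ≤ s' → s' ≤ T → (∫⁻ z, ENNReal.ofReal (((N : ℝ) + 1)⁻¹ * (Φ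
    N).collisionSum (Set.Ioc s s') (fun col => ‖col.preVel.1‖ ^ 2 * ‖col.preVel.2‖ ^ 2) z) ∂(localGibbsLaw σ
    a₀ u₀ θ₀ N (Φ N))) ≤ ENNReal.ofReal (C * (σ ^ 2 * ((N : ℝ) + 1) ^ (1 / 3 : ℝ) * (s' - s))) * (⨆ r ∈
    Set.Icc s s', (∫⁻ z, ENNReal.ofReal (((N : ℝ) + 1)⁻¹ * ∑ i : Fin (N + 1), ‖((Φ N).flow r z i).2‖ ^ 2)
    ∂(localGibbsLaw σ a₀ u₀ θ₀ N (Φ N)))) * (⨆ r ∈ Set.Icc s s', (∫⁻ z, ENNReal.ofReal (((N : ℝ) + 1)⁻¹ * ∑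
    i : Fin (N + 1), ‖((Φ N).flow r z i).2‖ ^ 3) ∂(localGibbsLaw σ a₀ u₀ θ₀ N (Φ N))))) → ∀ (a₀ θ₀ : T3 → ℝ)
    (u₀ : T3 → V3), Continuous a₀ → Continuous θ₀ → Continuous u₀ → (∀ x, 0 < a₀ x) → (∀ x, 0 < θ₀ x) → ∃ σ₀
    : ℝ, 0 < σ₀ ∧ ∀ σ : ℝ, 0 < σ → σ < σ₀ → ∀ T : ℝ, 0 < T → ∀ Φ : ((N : ℕ) → HardSphereFlow (Torus.geometry
    (Fin 3)) (hsDiameter σ N) (N + 1)), ∃ δ : ℝ, 0 < δ ∧ ∃ K₀ : ℝ, 0 ≤ K₀ ∧ ∃ C : ℝ, 0 ≤ C ∧ ∃ N₀ : ℕ, ∀ N :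
    ℕ, N₀ ≤ N → ∀ s : ℝ, 0 ≤ s → s + ((N : ℝ) + 1) ^ (-(1 / 3 : ℝ)) ≤ T → ENNReal.ofReal (δ * (σ ^ 2 * ((N :
    ℝ) + 1) ^ (1 / 3 : ℝ))) * (∫⁻ r in Set.Ioc s (s + ((N : ℝ) + 1) ^ (-(1 / 3 : ℝ)) / 2), (∫⁻ z,
    ENNReal.ofReal (((N : ℝ) + 1)⁻¹ * ∑ i : Fin (N + 1), (if K₀ < ‖((Φ N).flow r z i).2‖ then ‖((Φ N).flow r
    z i).2‖ ^ 4 else 0)) ∂(localGibbsLaw σ a₀ u₀ θ₀ N (Φ N)))) ≤ (∫⁻ z, ENNReal.ofReal (((N : ℝ) + 1)⁻¹ * (Φ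
    N).collisionSum (Set.Ioc s (s + ((N : ℝ) + 1) ^ (-(1 / 3 : ℝ)))) (fun col => max (‖col.preVel.1‖ ^ 4 +
    ‖col.preVel.2‖ ^ 4 - ‖col.postVel.1‖ ^ 4 - ‖col.postVel.2‖ ^ 4) 0 / 2) z) ∂(localGibbsLaw σ a₀ u₀ θ₀ N
    (Φ N))) + ENNReal.ofReal (C * (σ ^ 2 * ((N : ℝ) + 1) ^ (1 / 3 : ℝ) * (s + ((N : ℝ) + 1) ^ (-(1 / 3 : ℝ))
    - s))) * (⨆ r ∈ Set.Icc s (s + ((N : ℝ) + 1) ^ (-(1 / 3 : ℝ))), (∫⁻ z, ENNReal.ofReal (((N : ℝ) + 1)⁻¹ *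
    ∑ i : Fin (N + 1), ‖((Φ N).flow r z i).2‖ ^ 2) ∂(localGibbsLaw σ a₀ u₀ θ₀ N (Φ N)))) * (⨆ r ∈ Set.Icc s
    (s + ((N : ℝ) + 1) ^ (-(1 / 3 : ℝ))), (∫⁻ z, ENNReal.ofReal (((N : ℝ) + 1)⁻¹ * ∑ i : Fin (N + 1), ‖((Φ
    N).flow r z i).2‖ ^ 3) ∂(localGibbsLaw σ a₀ u₀ θ₀ N (Φ N)))) := by
  intro hQM hFX a₀ θ₀ u₀ ha hθ hu ha0 hθ0
  obtain ⟨σ₁, hσ₁, H1⟩ := hQM a₀ θ₀ u₀ ha hθ hu ha0 hθ0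
  obtain ⟨σ₃, hσ₃, H3⟩ := hFX a₀ θ₀ u₀ ha hθ hu ha0 hθ0
  refine ⟨min σ₁ (min σ₃ (1 / 2)), by positivity, ?_⟩
  intro σ hσ hσ0 T hT Φ
  obtain ⟨hσ₁', hσ₃', hσh⟩ : σ < σ₁ ∧ σ < σ₃ ∧ σ < 1 / 2 := by
    simpa only [lt_min_iff] using hσ0
  obtain ⟨K₀, hK₀, c, hc, N₁, HR⟩ := H1 σ hσ hσ₁' T hT Φ
  obtain ⟨C, hC, N₃, HF⟩ := H3 σ hσ hσ₃' T hT Φ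
  refine ⟨c / 2, by positivity, K₀, hK₀, C, hC, max N₁ N₃, ?_⟩
  intro N hN s hs hsT
  -- the kinetic window `(s, s']`, `s' = s + h_N`, `h_N = (N+1)^{-1/3} > 0`
  have hh : (0 : ℝ) < ((N : ℝ) + 1) ^ (-(1 / 3 : ℝ)) := Real.rpow_pos_of_pos (by positivity) _
  have hss' : s ≤ s + ((N : ℝ) + 1) ^ (-(1 / 3 : ℝ)) := le_add_of_nonneg_right hh.le
  have key₁ := HR N ((le_max_left _ _).trans hN) s hs hsT
  have key₃ := HF N ((le_max_right _ _).trans hN) s (s + ((N : ℝ) + 1) ^ (-(1 / 3 : ℝ))) hs hss' hsT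
  have hcast : ((N + 1 : ℕ) : ℝ) = (N : ℝ) + 1 := by push_cast; ring
  rw [hcast] at key₁
  set s' : ℝ := s + ((N : ℝ) + 1) ^ (-(1 / 3 : ℝ))
  set μ : Measure (Config (N + 1) (Fin 3) T3) := localGibbsLaw σ a₀ u₀ θ₀ N (Φ N)
  have hgood : ∀ᵐ z ∂μ, z ∈ (Φ N).good := ae_mem_good_localGibbsLaw σ a₀ u₀ θ₀ N (Φ N)
  have hε : hsDiameter σ N < 2⁻¹ := (hsDiameter_le hσ.le N).trans_lt (by rw [inv_eq_one_div]; exact hσh)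
  have hc' : (0 : ℝ) ≤ ((N : ℝ) + 1)⁻¹ := by positivity
  -- (1) the cut-off of QMF₄ᴸ is kept and the half-window left integral is carried through: `I′ = I`
  have h5 : (∫⁻ r in Set.Ioc s (s + ((N : ℝ) + 1) ^ (-(1 / 3 : ℝ)) / 2),
        (∫⁻ z, ENNReal.ofReal (((N : ℝ) + 1)⁻¹ *
          ∑ i : Fin (N + 1), (if K₀ < ‖((Φ N).flow r z i).2‖ then
            ‖((Φ N).flow r z i).2‖ ^ 4 else 0)) ∂μ)) ≤
      ∫⁻ τ in Set.Ioc s (s + ((N : ℝ) + 1) ^ (-(1 / 3 : ℝ)) / 2),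
        (∫⁻ z, ENNReal.ofReal (((N : ℝ) + 1)⁻¹ *
          ∑ i : Fin (N + 1), if K₀ < ‖(((Φ N).flow τ z) i).2‖ then
            ‖(((Φ N).flow τ z) i).2‖ ^ 4 else 0) ∂μ) := le_rfl
  -- (2) QMF₄ᴸ in collision-sum form (bridge on the good set: pre-velocity cut-off, post-vel. marks)
  have hP : ENNReal.ofReal (c * (σ ^ 2 * ((N : ℝ) + 1) ^ ((1 : ℝ) / 3))) *
      (∫⁻ τ in Set.Ioc s (s + ((N : ℝ) + 1) ^ (-(1 / 3 : ℝ)) / 2),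
        (∫⁻ z, ENNReal.ofReal (((N : ℝ) + 1)⁻¹ *
          ∑ i : Fin (N + 1), if K₀ < ‖(((Φ N).flow τ z) i).2‖ then
            ‖(((Φ N).flow τ z) i).2‖ ^ 4 else 0) ∂μ)) ≤
      ∫⁻ z, ENNReal.ofReal ((Φ N).collisionSum (Set.Ioc s s')
        (fun col => if K₀ < ‖col.preVel.1‖ then
          ((N : ℝ) + 1)⁻¹ * (2 * (‖col.postVel.1‖ ^ 2 * ‖col.postVel.2‖ ^ 2)) else 0) z) ∂μ := by
    refine key₁.trans_eq (lintegral_congr_ae ?_)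
    filter_upwards [hgood] with z hz
    exact c5lif2_bridge_mixpost_cutoff (Φ N) hz s s' K₀ _ hc'
  -- (3) dropping the cut-off record by record
  have hPQ : (∫⁻ z, ENNReal.ofReal ((Φ N).collisionSum (Set.Ioc s s')
        (fun col => if K₀ < ‖col.preVel.1‖ then
          ((N : ℝ) + 1)⁻¹ * (2 * (‖col.postVel.1‖ ^ 2 * ‖col.postVel.2‖ ^ 2)) else 0) z) ∂μ) ≤
      ∫⁻ z, ENNReal.ofReal ((Φ N).collisionSum (Set.Ioc s s')
        (fun col => ((N : ℝ) + 1)⁻¹ * (2 * (‖col.postVel.1‖ ^ 2 * ‖col.postVel.2‖ ^ 2))) z) ∂μ := by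
    refine lintegral_mono_ae ?_
    filter_upwards [hgood] with z hz
    exact ENNReal.ofReal_le_ofReal (c5lif2_cutoffMixSum_le_mixSum (Φ N) hz s s' K₀ hc')
  -- (4) the trivial step `ofReal 1 · Q ≤ Q`
  have hQR : ENNReal.ofReal 1 * (∫⁻ z, ENNReal.ofReal ((Φ N).collisionSum (Set.Ioc s s')
        (fun col => ((N : ℝ) + 1)⁻¹ * (2 * (‖col.postVel.1‖ ^ 2 * ‖col.postVel.2‖ ^ 2))) z) ∂μ) ≤
      ∫⁻ z, ENNReal.ofReal ((Φ N).collisionSum (Set.Ioc s s')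
        (fun col => ((N : ℝ) + 1)⁻¹ * (2 * (‖col.postVel.1‖ ^ 2 * ‖col.postVel.2‖ ^ 2))) z) ∂μ := by
    rw [ENNReal.ofReal_one, one_mul]
  -- (5) `2mix⁺ ≤ 2(Δ₄)₋/2 + 2mix⁻` record by record, integrated (the flux integrand is a.e.-measurable)
  have hR : (∫⁻ z, ENNReal.ofReal ((Φ N).collisionSum (Set.Ioc s s')
        (fun col => ((N : ℝ) + 1)⁻¹ * (2 * (‖col.postVel.1‖ ^ 2 * ‖col.postVel.2‖ ^ 2))) z)
        ∂μ) ≤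
      2 * (∫⁻ z, ENNReal.ofReal (((N : ℝ) + 1)⁻¹ *
          (Φ N).collisionSum (Set.Ioc s s')
            (fun col => max (‖col.preVel.1‖ ^ 4 + ‖col.preVel.2‖ ^ 4
              - ‖col.postVel.1‖ ^ 4 - ‖col.postVel.2‖ ^ 4) 0 / 2) z) ∂μ) +
      2 * (∫⁻ z, ENNReal.ofReal (((N : ℝ) + 1)⁻¹ *
          (Φ N).collisionSum (Set.Ioc s s')
            (fun col => ‖col.preVel.1‖ ^ 2 * ‖col.preVel.2‖ ^ 2) z) ∂μ) := by
    rw [← lintegral_const_mul' _ _ (ENNReal.ofNat_ne_top : (2 : ℝ≥0∞) ≠ ∞),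
      ← lintegral_const_mul' _ _ (ENNReal.ofNat_ne_top : (2 : ℝ≥0∞) ≠ ∞),
      ← lintegral_add_right' _
        ((((c5lif_aemeasurable_fluxSum hε (Φ N) s s' hgood).const_mul _).ennreal_ofReal).const_mul _)]
    refine lintegral_mono_ae ?_
    filter_upwards [hgood] with z hz
    exact c5lif_ofReal_mixpostSum_le (Φ N) hz s s' hc'
  -- (6) assemble with S2a″ on the window `(s, s']`
  have key := c5lif_assembly zero_le_one h5 hP hPQ hQR hR key₃
  rw [one_mul] at key
  exact key

end Summit.AtomisticToContinuum.HydrodynamicLimit.Theorems.QuarticSchurLedger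

end
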